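import Literature.AlgebraicGeometry.HodgeTheory.IntegralLefschetzOneOneIdeal
import Literature.AlgebraicGeometry.HodgeTheory.AnalytifiedVectorBundle
import Literature.AlgebraicTopology.CharacteristicClasses.FramedBundleTrivial
import Literature.AlgebraicGeometry.Motives.ComplexPointsManifold
import Literature.AlgebraicGeometry.Motives.VarietiesQuasiCompactProofs
import Literature.NumberTheory.Transcendental.AnalytificationSecondCountableProofs
import HarnessLib

/-!
# Chern classes of generically framed bundles are generically zero, integrally

Let `X` be a smooth projective variety over `ℂ` and `E` a complex topological vector bundle on
`X(ℂ)` (the tree's bundled `ComplexVectorBundle`, Husemoller Ch. 3) which is FRAMED OVER THE COMPLEX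
POINTS OF A NON-EMPTY ZARISKI OPEN: there are a Zariski-closed `Z ≠ X` and continuous sections
`σ₁, …, σ_r` of `E` over `(X ∖ Z)(ℂ)` forming a basis of every fibre. Every ALGEBRAIC vector bundle
(locally free `𝒪_X`-module of finite rank) read on `X(ℂ)` is of this kind — it is free on a
non-empty affine open `U = X ∖ Z`, and an algebraic frame over `U` is a holomorphic, in particular
continuous, frame over `U(ℂ)` (Serre, FAC n°41 and GAGA §4 n°20) — as is, more generally, every
topological bundle trivial over such a `U(ℂ)`. Then for `i ≥ 1` the integral Chern class
`cᵢ(E) ∈ H²ⁱ(X(ℂ); ℤ)` (Husemoller Ch. 17, the tree's PROVED theory `theChernClassTheory` /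
`chernClassZ`) restricts to ZERO in `H²ⁱ((X ∖ Z)(ℂ); ℤ)`: by naturality (C₁),
`cᵢ(E)|_{(X∖Z)(ℂ)} = cᵢ(E|_{(X∖Z)(ℂ)})`, and a framed bundle is trivial, so its positive-degree Chern
classes vanish (Milnor–Stasheff §2 Thm. 2.2 + Husemoller Ch. 17 Prop. 4.1, the tree's
`ComplexVectorBundle.chernClassZ_eq_zero_of_frame`). No torsion is lost: the vanishing is in
INTEGRAL cohomology, exactly (contrast: for the cycle class of a codimension-`p` subvariety only
the multiple `(p-1)! · cl(W) = ± c_p(𝒪_W)` is a Chern class, Fulton Ex. 15.3.1). Consequently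
(Bloch–Ogus coniveau `N¹`, the tree's `coniveauFiltration ℤ X k 1` = classes dying on the complex
points of a non-empty Zariski open, and its two-sided cup-ideal property
`cupProduct_mem_coniveauFiltration_of_left/right`):

* `paracompactSpace_complexPointsCompl_of_isSmoothProjective` — `(X ∖ Z)(ℂ)` is paracompact
  (open in the compact metrisable `X(ℂ)`: locally compact and second countable, Serre GAGA §2 n°5),
  the standing hypothesis (2.4) of Husemoller's Ch. 17 under which (C₁) is available;
* `chernClassZ_restrictToCompl_eq_zero_of_frame` — **`cᵢ(E)|_{(X∖Z)(ℂ)} = 0` in `H²ⁱ((X∖Z)(ℂ); ℤ)`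
  for `i ≥ 1` if `E` is framed over `(X ∖ Z)(ℂ)`**;
* `chernClassZ_mem_coniveauFiltration_one_of_frame` — hence `cᵢ(E) ∈ N¹ H²ⁱ(X(ℂ); ℤ)` when
  `Z ≠ X`;
* `cupProduct_chernClassZ_mem_coniveauFiltration_one_of_frame_left/right`,
  `span_cupProduct_chernClassZ_le_coniveauFiltration_one` — the two-sided ideal of `H^*(X(ℂ); ℤ)`
  generated by these Chern classes (the "Chern ideal": sums of `cᵢ(E) ⌣ w`, `w ⌣ cᵢ(E)`, `w`
  arbitrary, in particular all Chern monomials of positive degree in several such bundles) lies in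
  `N¹ H^*(X(ℂ); ℤ)`;
* `exists_restrictToCompl_eq_zero_of_mem_span_cupProduct_chernClassZ` — unfolded: every class in
  the Chern ideal dies on the complex points of ONE non-empty Zariski open, integrally;
* `chernClassZ_analytification_restrictToCompl_eq_zero_of_isSectionFrame`,
  `chernClassZ_analytification_mem_coniveauFiltration_one_of_isFinLocallyFreeOn` — the ALGEBRAIC
  case in the tree's GAGA vocabulary (`IsSectionFrame`, `IsFinLocallyFreeOn`,
  `IsAnalytifiedVectorBundle` of `AnalytifiedVectorBundle.lean`): if `(V, α)` is the analytification
  along `ψ : N ≃ₜ X(ℂ)` of an `𝒪_X`-module `F` finite locally free on a non-empty Zariski open, then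
  the Chern classes of `V` (read on `X(ℂ)` through `ψ`) restrict to zero over every trivialising
  open of `F` and lie in `N¹ H^*(X(ℂ); ℤ)` — the algebraic frame is a holomorphic, hence
  continuous, frame of `V`; `HodgeModel.chernClassZ_analytifiedVectorBundle_restrictToCompl_eq_zero`,
  `HodgeModel.chernClassZ_analytifiedVectorBundle_mem_coniveauFiltration_one` — the same for an
  analytification datum `𝓕 : A.AnalytifiedVectorBundle Fib F` over a Hodge model `A` of `X`
  (`A.toComplexPoints : X^an → X(ℂ)`).

This complements `IntegralLefschetzOneOneIdeal` (the ideal of the integral `(1,1)`-classes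
`= c₁` of line bundles, where the frame comes from the Lefschetz theorem on `(1,1)`-classes rather
than being given): `c₂` of a rank-two bundle is in general NOT in the ideal of divisor classes
(e.g. `σ₁₁ = c₂` of the tautological sub-bundle on the quadric fourfold `G(2,4)`, whose divisor ideal in
`H⁴ ≅ ℤ²` is `ℤ · σ₁² = ℤ(σ₁₁ + σ₂)`), while rationally the Chern subring of the algebraic bundles is
the whole ring of algebraic classes (`ch : K₀(X) ⊗ ℚ ≅ CH^*(X) ⊗ ℚ`, Fulton Thm. 15.2.16 / Ex. 15.2.16).

Everything is proved; no definitions, no named facts.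

## References

* D. Husemoller, *Fibre Bundles*, 3rd ed., GTM 20 (1994), Ch. 3 §§1–3; Ch. 17 (2.4), §3 (C₁),
  Prop. 3.3, Prop. 4.1. [HusemollerFibreBundles1994]
* J. Milnor, J. Stasheff, *Characteristic Classes* (1974), §2 Thm. 2.2, §14. [MilnorStasheff1974]
* S. Bloch, A. Ogus, *Gersten's conjecture and the homology of schemes*, Ann. Sci. ÉNS 7 (1974),
  (3.8). [BlochOgus1974ENS]
* J.-P. Serre, *Faisceaux algébriques cohérents*, Ann. Math. 61 (1955), n°41; *Géométrie algébrique
  et géométrie analytique*, Ann. Inst. Fourier 6 (1956), §2 n°5, §4 n°20. [SerreFAC1955] [SerreGAGA1956]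
* W. Fulton, *Intersection Theory*, 2nd ed. (1998), Thm. 15.2.16, Ex. 15.3.1. [Fulton1998]
* A. Hatcher, *Algebraic Topology* (2002), Prop. 3.10. [HatcherAT2002]
-/

noncomputable section

open Bundle Topology
open Literature.AlgebraicTopology.SingularHomology Literature.AlgebraicTopology.CharacteristicClasses
open Literature.AlgebraicGeometry.Motives AlgebraicGeometry

namespace Literature.AlgebraicGeometry.HodgeTheory

variable {n : ℕ} {X : SchemeOver ℂ}

/-! ### Point-set topology of `X(ℂ)` and `(X ∖ Z)(ℂ)` for `X` smooth projective -/

section Topology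

/-- `X(ℂ)` is second countable for `X` smooth projective over `ℂ` (a finite union of closed subspaces
of affine spaces; Serre, GAGA §2 n°5; the tree's PROVED
`ComplexPoints.secondCountableTopology_of_compactSpace_holds`). [cite: SerreGAGA1956, §2 n°5] -/
theorem secondCountableTopology_complexPoints_of_isSmoothProjective (hX : IsSmoothProjective n X) :
    SecondCountableTopology (ComplexPoints X) := by
  haveI : IsProper X.hom := IsSmoothProjective.isProper_holds hX
  haveI := IsSmoothProjective.compactSpace_holds hX
  exact ComplexPoints.secondCountableTopology_of_compactSpace_holds X

/-- `X(ℂ)` is paracompact for `X` smooth projective over `ℂ` (it is compact).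
[cite: HusemollerFibreBundles1994, Ch. 17 (2.4)] -/
theorem paracompactSpace_complexPoints_of_isSmoothProjective (hX : IsSmoothProjective n X) :
    ParacompactSpace (ComplexPoints X) := by
  haveI := ComplexPoints.compactSpace_of_isSmoothProjective hX
  infer_instance

/-- `(X ∖ Z)(ℂ)` is locally compact for `X` smooth projective over `ℂ` and `Z` Zariski-closed
(an open subspace of the compact Hausdorff `X(ℂ)`). [cite: SerreGAGA1956, §2 n°5] -/
theorem locallyCompactSpace_complexPointsCompl_of_isSmoothProjective (hX : IsSmoothProjective n X)
    {Z : Set X.left} (hZ : IsClosed Z) : LocallyCompactSpace (complexPointsCompl X Z) := by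
  haveI := ComplexPoints.compactSpace_of_isSmoothProjective hX
  haveI := ComplexPoints.t2Space_of_isSmoothProjective hX
  have hopen : IsOpen {P : ComplexPoints X | P.pt ∉ Z} :=
    AlgPoints.isOpen_setOf_pt_mem (X := X) (L := ℂ) ⟨Zᶜ, hZ.isOpen_compl⟩
  exact hopen.locallyCompactSpace

/-- `(X ∖ Z)(ℂ)` is second countable for `X` smooth projective over `ℂ` (a subspace of the second
countable `X(ℂ)`). [cite: SerreGAGA1956, §2 n°5] -/
theorem secondCountableTopology_complexPointsCompl_of_isSmoothProjective
    (hX : IsSmoothProjective n X) (Z : Set X.left) :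
    SecondCountableTopology (complexPointsCompl X Z) := by
  haveI := secondCountableTopology_complexPoints_of_isSmoothProjective hX
  exact Topology.IsEmbedding.subtypeVal.secondCountableTopology

/-- **`(X ∖ Z)(ℂ)` is paracompact** for `X` smooth projective over `ℂ` and `Z` Zariski-closed:
locally compact, Hausdorff and second countable, hence σ-compact, hence paracompact — Husemoller's
standing hypothesis (2.4) for the Chern classes of Ch. 17. [cite: HusemollerFibreBundles1994, Ch. 17 (2.4)]
[cite: SerreGAGA1956, §2 n°5] -/
theorem paracompactSpace_complexPointsCompl_of_isSmoothProjective (hX : IsSmoothProjective n X)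
    {Z : Set X.left} (hZ : IsClosed Z) : ParacompactSpace (complexPointsCompl X Z) := by
  haveI := ComplexPoints.t2Space_of_isSmoothProjective hX
  haveI := locallyCompactSpace_complexPointsCompl_of_isSmoothProjective hX hZ
  haveI := secondCountableTopology_complexPointsCompl_of_isSmoothProjective hX Z
  haveI : SigmaCompactSpace (complexPointsCompl X Z) :=
    sigmaCompactSpace_of_locallyCompact_secondCountable
  infer_instance

end Topology

/-! ### Chern classes of a bundle framed over `(X ∖ Z)(ℂ)` die on `(X ∖ Z)(ℂ)` -/

section Frame

/-- A continuous section of `E` over the subspace `(X ∖ Z)(ℂ) ⊆ X(ℂ)` (continuous as a map into the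
total space of `E`) is a continuous section of the restricted bundle `E|_{(X∖Z)(ℂ)} = ι^*E`
(the pull-back topology is induced by the projection and the lift to `E`, Husemoller Ch. 2 §5).
[cite: HusemollerFibreBundles1994, Ch. 3 §3] -/
theorem continuous_section_pullback_of_continuous
    (E : ComplexVectorBundle.{0, 0} (ComplexPoints X)) (Z : Set X.left)
    (s : (P : complexPointsCompl X Z) → E.E P.1)
    (hs : Continuous fun P : complexPointsCompl X Z ↦ (⟨P.1, s P⟩ : TotalSpace E.F E.E)) :
    Continuous fun P : complexPointsCompl X Z ↦
      (⟨P, s P⟩ : TotalSpace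
        (E.pullback (⟨Subtype.val, continuous_subtype_val⟩ :
          C(complexPointsCompl X Z, ComplexPoints X))).F
        (E.pullback (⟨Subtype.val, continuous_subtype_val⟩ :
          C(complexPointsCompl X Z, ComplexPoints X))).E) := by
  refine (inducing_pullbackTotalSpaceEmbedding E.F E.E
    (Subtype.val : complexPointsCompl X Z → ComplexPoints X)).continuous_iff.2 ?_
  exact continuous_id.prodMk hs

/-- **Chern classes of a generically framed bundle restrict to zero, integrally.** For `X` smooth
projective over `ℂ`, `E` a complex vector bundle on `X(ℂ)`, `Z ⊆ X` Zariski-closed and `σ₁, …, σ_r`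
continuous sections of `E` over `(X ∖ Z)(ℂ)` forming a basis of every fibre `E_P`, `P ∉ Z(ℂ)`:
`cᵢ(E)|_{(X∖Z)(ℂ)} = 0` in `H²ⁱ((X ∖ Z)(ℂ); ℤ)` for every `i ≥ 1` — naturality (C₁)
`cᵢ(E)| = cᵢ(E|)` and vanishing of the positive Chern classes of the framed, hence trivial,
bundle `E|_{(X∖Z)(ℂ)}`. [cite: HusemollerFibreBundles1994, Ch. 17 §3 (C₁), Prop. 3.3 and Prop. 4.1]
[cite: MilnorStasheff1974, §2 Thm. 2.2] -/
theorem chernClassZ_restrictToCompl_eq_zero_of_frame (hX : IsSmoothProjective n X)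
    (E : ComplexVectorBundle.{0, 0} (ComplexPoints X)) {Z : Set X.left} (hZ : IsClosed Z)
    {ι : Type} [Fintype ι] (σ : ι → (P : complexPointsCompl X Z) → E.E P.1)
    (hσc : ∀ j, Continuous fun P : complexPointsCompl X Z ↦ (⟨P.1, σ j P⟩ : TotalSpace E.F E.E))
    (hσb : ∀ P : complexPointsCompl X Z,
      LinearIndependent ℂ (fun j ↦ σ j P) ∧ ⊤ ≤ Submodule.span ℂ (Set.range fun j ↦ σ j P))
    {i : ℕ} (hi : 0 < i) :
    restrictToCompl ℤ X (2 * i) Z (chernClassZ E i) = 0 := by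
  haveI := ComplexPoints.t2Space_of_isSmoothProjective hX
  haveI := paracompactSpace_complexPoints_of_isSmoothProjective hX
  haveI := paracompactSpace_complexPointsCompl_of_isSmoothProjective hX hZ
  let f : C(complexPointsCompl X Z, ComplexPoints X) := ⟨Subtype.val, continuous_subtype_val⟩
  -- (C₁): `cᵢ(E|) = cᵢ(E)|`
  have hnat : chernClassZ (E.pullback f) i =
      singularCohomology.map ℤ ℤ f (2 * i) (chernClassZ E i) :=
    theChernClassTheory.chernClass_pullback f E i
  -- the given frame is a frame of the restricted bundle, whose positive Chern classes vanish
  have hσc' : ∀ j, Continuous fun P : complexPointsCompl X Z ↦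
      (⟨P, σ j P⟩ : TotalSpace (E.pullback f).F (E.pullback f).E) :=
    fun j ↦ continuous_section_pullback_of_continuous E Z (σ j) (hσc j)
  have h0 : chernClassZ (E.pullback f) i = 0 :=
    ComplexVectorBundle.chernClassZ_eq_zero_of_frame (E.pullback f) (fun j P ↦ σ j P) hσc' hσb hi
  change singularCohomology.map ℤ ℤ f (2 * i) (chernClassZ E i) = 0
  rw [← hnat, h0]

/-- **`cᵢ(E) ∈ N¹ H²ⁱ(X(ℂ); ℤ)` for a bundle framed over the complex points of a NON-EMPTY Zariski
open** (`Z ≠ X`), `i ≥ 1`. [cite: HusemollerFibreBundles1994, Ch. 17 §3 (C₁) and Prop. 4.1]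
[cite: BlochOgus1974ENS, (3.8)] -/
theorem chernClassZ_mem_coniveauFiltration_one_of_frame (hX : IsSmoothProjective n X)
    (E : ComplexVectorBundle.{0, 0} (ComplexPoints X)) {Z : Set X.left} (hZ : IsClosed Z)
    (hZne : Z ≠ Set.univ)
    {ι : Type} [Fintype ι] (σ : ι → (P : complexPointsCompl X Z) → E.E P.1)
    (hσc : ∀ j, Continuous fun P : complexPointsCompl X Z ↦ (⟨P.1, σ j P⟩ : TotalSpace E.F E.E))
    (hσb : ∀ P : complexPointsCompl X Z,
      LinearIndependent ℂ (fun j ↦ σ j P) ∧ ⊤ ≤ Submodule.span ℂ (Set.range fun j ↦ σ j P))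
    {i : ℕ} (hi : 0 < i) :
    chernClassZ E i ∈ coniveauFiltration ℤ X (2 * i) 1 := by
  haveI := IsSmoothProjective.isIntegral_holds hX
  exact (exists_ne_univ_restrictToCompl_eq_zero_iff_mem_coniveauFiltration_one ℤ _).1
    ⟨Z, hZ, hZne, chernClassZ_restrictToCompl_eq_zero_of_frame hX E hZ σ hσc hσb hi⟩

/-- **`cᵢ(E) ⌣ w ∈ N¹`** for `E` framed over the complex points of a non-empty Zariski open, `i ≥ 1`,
`w ∈ H^q(X(ℂ); ℤ)` arbitrary, `2i + q = k`. [cite: HusemollerFibreBundles1994, Ch. 17 §3 (C₁) and Prop. 4.1]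
[cite: HatcherAT2002, Prop. 3.10] -/
theorem cupProduct_chernClassZ_mem_coniveauFiltration_one_of_frame_left
    (hX : IsSmoothProjective n X)
    (E : ComplexVectorBundle.{0, 0} (ComplexPoints X)) {Z : Set X.left} (hZ : IsClosed Z)
    (hZne : Z ≠ Set.univ)
    {ι : Type} [Fintype ι] (σ : ι → (P : complexPointsCompl X Z) → E.E P.1)
    (hσc : ∀ j, Continuous fun P : complexPointsCompl X Z ↦ (⟨P.1, σ j P⟩ : TotalSpace E.F E.E))
    (hσb : ∀ P : complexPointsCompl X Z,
      LinearIndependent ℂ (fun j ↦ σ j P) ∧ ⊤ ≤ Submodule.span ℂ (Set.range fun j ↦ σ j P))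
    {i : ℕ} (hi : 0 < i) {q k : ℕ} (h : 2 * i + q = k)
    (w : singularCohomology ℤ ℤ (ComplexPoints X) q) :
    cupProduct h (chernClassZ E i) w ∈ coniveauFiltration ℤ X k 1 :=
  cupProduct_mem_coniveauFiltration_of_left ℤ h
    (chernClassZ_mem_coniveauFiltration_one_of_frame hX E hZ hZne σ hσc hσb hi) w

/-- **`w ⌣ cᵢ(E) ∈ N¹`** for `E` framed over the complex points of a non-empty Zariski open, `i ≥ 1`,
`w ∈ H^q(X(ℂ); ℤ)` arbitrary, `q + 2i = k`. [cite: HusemollerFibreBundles1994, Ch. 17 §3 (C₁) and Prop. 4.1]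
[cite: HatcherAT2002, Prop. 3.10] -/
theorem cupProduct_chernClassZ_mem_coniveauFiltration_one_of_frame_right
    (hX : IsSmoothProjective n X)
    (E : ComplexVectorBundle.{0, 0} (ComplexPoints X)) {Z : Set X.left} (hZ : IsClosed Z)
    (hZne : Z ≠ Set.univ)
    {ι : Type} [Fintype ι] (σ : ι → (P : complexPointsCompl X Z) → E.E P.1)
    (hσc : ∀ j, Continuous fun P : complexPointsCompl X Z ↦ (⟨P.1, σ j P⟩ : TotalSpace E.F E.E))
    (hσb : ∀ P : complexPointsCompl X Z,
      LinearIndependent ℂ (fun j ↦ σ j P) ∧ ⊤ ≤ Submodule.span ℂ (Set.range fun j ↦ σ j P))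
    {i : ℕ} (hi : 0 < i) {q k : ℕ} (h : q + 2 * i = k)
    (w : singularCohomology ℤ ℤ (ComplexPoints X) q) :
    cupProduct h w (chernClassZ E i) ∈ coniveauFiltration ℤ X k 1 :=
  cupProduct_mem_coniveauFiltration_of_right ℤ h w
    (chernClassZ_mem_coniveauFiltration_one_of_frame hX E hZ hZne σ hσc hσb hi)

/-- **The Chern ideal lies in `N¹ H^*(X(ℂ); ℤ)`.** The `ℤ`-span of the degree-`k` generators of the
two-sided ideal of `H^*(X(ℂ); ℤ)` generated by the positive-degree Chern classes of the complex
vector bundles on `X(ℂ)` framed (by `r` continuous sections, a basis fibrewise) over the complex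
points of a non-empty Zariski open — the cup products `cᵢ(E) ⌣ w` (`2i + q = k`) and `w ⌣ cᵢ(E)`
(`q + 2i = k`), `i ≥ 1`, `w ∈ H^q(X(ℂ); ℤ)` arbitrary — is contained in the coniveau-`1` integral
classes. [cite: HusemollerFibreBundles1994, Ch. 17 §3 (C₁) and Prop. 4.1] [cite: BlochOgus1974ENS, (3.8)] -/
theorem span_cupProduct_chernClassZ_le_coniveauFiltration_one (hX : IsSmoothProjective n X)
    (k : ℕ) :
    Submodule.span ℤ {z : singularCohomology ℤ ℤ (ComplexPoints X) k |
        ∃ (i r q : ℕ) (E : ComplexVectorBundle.{0, 0} (ComplexPoints X)) (Z : Set X.left)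
          (σ : Fin r → (P : complexPointsCompl X Z) → E.E P.1)
          (w : singularCohomology ℤ ℤ (ComplexPoints X) q),
          0 < i ∧ IsClosed Z ∧ Z ≠ Set.univ ∧
          (∀ j, Continuous fun P : complexPointsCompl X Z ↦ (⟨P.1, σ j P⟩ : TotalSpace E.F E.E)) ∧
          (∀ P : complexPointsCompl X Z, LinearIndependent ℂ (fun j ↦ σ j P) ∧
            ⊤ ≤ Submodule.span ℂ (Set.range fun j ↦ σ j P)) ∧
          ((∃ h : 2 * i + q = k, z = cupProduct h (chernClassZ E i) w) ∨
            (∃ h : q + 2 * i = k, z = cupProduct h w (chernClassZ E i)))} ≤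
      coniveauFiltration ℤ X k 1 := by
  refine Submodule.span_le.2 ?_
  rintro z ⟨i, r, q, E, Z, σ, w, hi, hZ, hZne, hσc, hσb, (⟨h, rfl⟩ | ⟨h, rfl⟩)⟩
  · exact cupProduct_chernClassZ_mem_coniveauFiltration_one_of_frame_left hX E hZ hZne σ hσc hσb
      hi h w
  · exact cupProduct_chernClassZ_mem_coniveauFiltration_one_of_frame_right hX E hZ hZne σ hσc hσb
      hi h w

/-- **Unfolded: classes in the Chern ideal die on a non-empty Zariski open, integrally.** For `X`
smooth projective over `ℂ` and `z ∈ Hᵏ(X(ℂ); ℤ)` in the `ℤ`-span of the cup products `cᵢ(E) ⌣ w`,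
`w ⌣ cᵢ(E)` (`i ≥ 1`, `E` framed over the complex points of a non-empty Zariski open), there is a
Zariski-closed `Z ≠ X` with `z|_{(X ∖ Z)(ℂ)} = 0` in `Hᵏ((X ∖ Z)(ℂ); ℤ)`.
[cite: HusemollerFibreBundles1994, Ch. 17 §3 (C₁) and Prop. 4.1] [cite: BlochOgus1974ENS, (3.8)] -/
theorem exists_restrictToCompl_eq_zero_of_mem_span_cupProduct_chernClassZ
    (hX : IsSmoothProjective n X) {k : ℕ} {z : singularCohomology ℤ ℤ (ComplexPoints X) k}
    (hz : z ∈ Submodule.span ℤ {z : singularCohomology ℤ ℤ (ComplexPoints X) k |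
        ∃ (i r q : ℕ) (E : ComplexVectorBundle.{0, 0} (ComplexPoints X)) (Z : Set X.left)
          (σ : Fin r → (P : complexPointsCompl X Z) → E.E P.1)
          (w : singularCohomology ℤ ℤ (ComplexPoints X) q),
          0 < i ∧ IsClosed Z ∧ Z ≠ Set.univ ∧
          (∀ j, Continuous fun P : complexPointsCompl X Z ↦ (⟨P.1, σ j P⟩ : TotalSpace E.F E.E)) ∧
          (∀ P : complexPointsCompl X Z, LinearIndependent ℂ (fun j ↦ σ j P) ∧
            ⊤ ≤ Submodule.span ℂ (Set.range fun j ↦ σ j P)) ∧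
          ((∃ h : 2 * i + q = k, z = cupProduct h (chernClassZ E i) w) ∨
            (∃ h : q + 2 * i = k, z = cupProduct h w (chernClassZ E i)))}) :
    ∃ Z : Set X.left, IsClosed Z ∧ Z ≠ Set.univ ∧
      singularCohomology.map ℤ ℤ
        (⟨Subtype.val, continuous_subtype_val⟩ : C(complexPointsCompl X Z, ComplexPoints X)) k z = 0 := by
  haveI := IsSmoothProjective.isIntegral_holds hX
  exact (exists_ne_univ_restrictToCompl_eq_zero_iff_mem_coniveauFiltration_one ℤ z).2
    (span_cupProduct_chernClassZ_le_coniveauFiltration_one hX k hz)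

end Frame

/-! ### Algebraic vector bundles: Chern classes of an analytification have coniveau `≥ 1` -/

section GAGA

open scoped Manifold ContDiff

variable {EN : Type*} [NormedAddCommGroup EN] [NormedSpace ℂ EN] {HN : Type*} [TopologicalSpace HN]
  {I : ModelWithCorners ℂ EN HN} {N : Type} [TopologicalSpace N] [ChartedSpace HN N]
  {Fib : Type} [NormedAddCommGroup Fib] [NormedSpace ℂ Fib] [FiniteDimensional ℂ Fib]
  {V : N → Type} [TopologicalSpace (TotalSpace Fib V)] [∀ x, AddCommGroup (V x)]
  [∀ x, Module ℂ (V x)] [∀ x, TopologicalSpace (V x)] [FiberBundle Fib V] [VectorBundle ℂ Fib V]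

/-- **Chern classes of (the analytification of) an algebraic vector bundle restrict to zero on the
complex points of a trivialising open, integrally.** Let `ψ : N ≃ₜ X(ℂ)` (e.g. an analytification
of the smooth projective `X`), `F` an `𝒪_X`-module with a frame `s₁, …, s_r` over the Zariski open
`U` (Stacks 01C6), and `(V, α)` the analytification of `F` along `ψ` (GAGA comparison predicate
`IsAnalytifiedVectorBundle`: `α` sends algebraic frames to holomorphic, fibrewise-basis sections,
Serre GAGA §3 n°9, §4 n°20). Then `cᵢ(V)|_{U(ℂ)} = 0` in `H²ⁱ(U(ℂ); ℤ)` for `i ≥ 1`, `V` being read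
on `X(ℂ)` through `ψ` (as the pull-back of `V` along `ψ⁻¹`, Husemoller Ch. 3 §3).
[cite: SerreGAGA1956, §3 n°9 Déf. 2 and §4 n°20]
[cite: HusemollerFibreBundles1994, Ch. 17 §3 (C₁) and Prop. 4.1] -/
theorem chernClassZ_analytification_restrictToCompl_eq_zero_of_isSectionFrame
    (hX : IsSmoothProjective n X) (ψ : N ≃ₜ ComplexPoints X) {F : X.left.Modules}
    {α : ∀ W : X.left.Opens, Γ(F, W) → ∀ x : N, V x}
    (h : IsAnalytifiedVectorBundle I Fib ψ F α) {U : X.left.Opens} {r : ℕ} {s : Fin r → Γ(F, U)}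
    (hs : IsSectionFrame F U s) {i : ℕ} (hi : 0 < i) :
    restrictToCompl ℤ X (2 * i) ((U : Set X.left)ᶜ)
      (chernClassZ (({ F := Fib, E := V } : ComplexVectorBundle.{0, 0} N).pullback
        ⟨ψ.symm, ψ.continuous_symm⟩) i) = 0 := by
  -- the algebraic frame, read through `ψ⁻¹`, frames the transported bundle over `U(ℂ)`
  have hmem : ∀ P : complexPointsCompl X ((U : Set X.left)ᶜ), (ψ (ψ.symm P.1)).pt ∈ U := by
    intro P
    rw [ψ.apply_symm_apply]
    exact Set.notMem_compl_iff.1 P.2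
  refine chernClassZ_restrictToCompl_eq_zero_of_frame hX
    (({ F := Fib, E := V } : ComplexVectorBundle.{0, 0} N).pullback ⟨ψ.symm, ψ.continuous_symm⟩)
    U.2.isClosed_compl (fun j P ↦ α U (s j) (ψ.symm P.1)) (fun j ↦ ?_)
    (fun P ↦ h.frame U r s hs (ψ.symm P.1) (hmem P)) hi
  -- continuity: into the total space of the pull-back along `ψ⁻¹`, i.e. of `P ↦ ψ⁻¹ P` and of the
  -- holomorphic section `x ↦ α(s_j)(x)` of `V` on `ψ⁻¹(U(ℂ))`
  refine (inducing_pullbackTotalSpaceEmbedding Fib V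
    (ψ.symm : ComplexPoints X → N)).continuous_iff.2 ?_
  refine continuous_subtype_val.prodMk ?_
  have hc := h.continuousOn U (s j)
  have hmaps : Set.MapsTo (fun P : complexPointsCompl X ((U : Set X.left)ᶜ) ↦ ψ.symm P.1)
      Set.univ (ψ ⁻¹' {P | P.pt ∈ U}) := fun P _ ↦ hmem P
  have hcont : Continuous fun P : complexPointsCompl X ((U : Set X.left)ᶜ) ↦ ψ.symm P.1 :=
    ψ.continuous_symm.comp continuous_subtype_val
  exact continuousOn_univ.1 (hc.comp hcont.continuousOn hmaps)

/-- **Chern classes of an algebraic vector bundle have integral coniveau `≥ 1`.** For `X` smooth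
projective over `ℂ`, `ψ : N ≃ₜ X(ℂ)`, an `𝒪_X`-module `F` which is finite locally free on a
non-empty Zariski open `U` (an algebraic vector bundle near the generic point) and `(V, α)` its
analytification along `ψ`: `cᵢ(V) ∈ N¹ H²ⁱ(X(ℂ); ℤ)` for every `i ≥ 1` (`V` read on `X(ℂ)` through
`ψ`) — `F` is free on a smaller non-empty open, over whose complex points the algebraic frame is a
continuous frame of `V`. [cite: SerreGAGA1956, §3 n°9 Déf. 2 and §4 n°20]
[cite: HusemollerFibreBundles1994, Ch. 17 §3 (C₁) and Prop. 4.1] [cite: BlochOgus1974ENS, (3.8)] -/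
theorem chernClassZ_analytification_mem_coniveauFiltration_one_of_isFinLocallyFreeOn
    (hX : IsSmoothProjective n X) (ψ : N ≃ₜ ComplexPoints X) {F : X.left.Modules}
    {α : ∀ W : X.left.Opens, Γ(F, W) → ∀ x : N, V x}
    (h : IsAnalytifiedVectorBundle I Fib ψ F α) {U : X.left.Opens}
    (hU : (U : Set X.left).Nonempty) (hF : IsFinLocallyFreeOn F U) {i : ℕ} (hi : 0 < i) :
    chernClassZ (({ F := Fib, E := V } : ComplexVectorBundle.{0, 0} N).pullback
        ⟨ψ.symm, ψ.continuous_symm⟩) i ∈ coniveauFiltration ℤ X (2 * i) 1 := by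
  haveI := IsSmoothProjective.isIntegral_holds hX
  obtain ⟨x, hx⟩ := hU
  obtain ⟨W, r, s, hxW, -, hs⟩ := hF x hx
  have hWne : ((W : Set X.left)ᶜ) ≠ Set.univ := by
    intro hW
    have : x ∈ ((W : Set X.left)ᶜ) := hW ▸ Set.mem_univ x
    exact this hxW
  exact (exists_ne_univ_restrictToCompl_eq_zero_iff_mem_coniveauFiltration_one ℤ _).1
    ⟨(W : Set X.left)ᶜ, W.2.isClosed_compl, hWne,
      chernClassZ_analytification_restrictToCompl_eq_zero_of_isSectionFrame hX ψ h hs hi⟩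

end GAGA

/-! ### Specialisation to Hodge models `X^an → X(ℂ)` -/

section HodgeModelAnalytification

open scoped Manifold ContDiff

variable {Fib : Type} [NormedAddCommGroup Fib] [NormedSpace ℂ Fib] [FiniteDimensional ℂ Fib]

/-- **Chern classes of `F^an` on a Hodge model restrict to zero over a trivialising open,
integrally.** For `X` smooth projective over `ℂ` with Hodge model `A` (analytification
`A.toComplexPoints : X^an → X(ℂ)`, a homeomorphism), an `𝒪_X`-module `F` with a frame over the
Zariski open `U` and an analytification datum `𝓕 : A.AnalytifiedVectorBundle Fib F` (GAGA §3 n°9):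
`cᵢ(F^an)|_{U(ℂ)} = 0` in `H²ⁱ(U(ℂ); ℤ)` for `i ≥ 1`, the holomorphic bundle `𝓕.bundle` being read
on `X(ℂ)` through `X^an ≃ₜ X(ℂ)`. [cite: SerreGAGA1956, §3 n°9 Déf. 2 and §4 n°20]
[cite: HusemollerFibreBundles1994, Ch. 17 §3 (C₁) and Prop. 4.1] -/
theorem HodgeModel.chernClassZ_analytifiedVectorBundle_restrictToCompl_eq_zero
    (hX : IsSmoothProjective n X) (A : HodgeModel n X) {F : X.left.Modules}
    (𝓕 : A.AnalytifiedVectorBundle Fib F) {U : X.left.Opens} {r : ℕ} {s : Fin r → Γ(F, U)}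
    (hs : IsSectionFrame F U s) {i : ℕ} (hi : 0 < i) :
    restrictToCompl ℤ X (2 * i) ((U : Set X.left)ᶜ)
      (chernClassZ (({ F := Fib, E := 𝓕.bundle } : ComplexVectorBundle.{0, 0} A.carrier).pullback
        ⟨A.isAnalytification.homeomorph.symm, A.isAnalytification.homeomorph.continuous_symm⟩) i) =
      0 :=
  chernClassZ_analytification_restrictToCompl_eq_zero_of_isSectionFrame (I := 𝓘(ℂ, A.model)) hX
    A.isAnalytification.homeomorph 𝓕.isAnalytifiedVectorBundle hs hi

/-- **Chern classes of `F^an` on a Hodge model have integral coniveau `≥ 1`.** For `X` smooth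
projective over `ℂ` with Hodge model `A`, an `𝒪_X`-module `F` finite locally free on a non-empty
Zariski open `U` (every algebraic vector bundle on `X`, or on a dense open of `X`) and an
analytification datum `𝓕 : A.AnalytifiedVectorBundle Fib F`: `cᵢ(F^an) ∈ N¹ H²ⁱ(X(ℂ); ℤ)` for every
`i ≥ 1` (`𝓕.bundle` read on `X(ℂ)` through `X^an ≃ₜ X(ℂ)`), hence every class of the cup ideal
these Chern classes generate dies on the complex points of a non-empty Zariski open, integrally
(`cupProduct_mem_coniveauFiltration_of_left/right`). [cite: SerreGAGA1956, §3 n°9 Déf. 2 and §4 n°20]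
[cite: HusemollerFibreBundles1994, Ch. 17 §3 (C₁) and Prop. 4.1] [cite: BlochOgus1974ENS, (3.8)] -/
theorem HodgeModel.chernClassZ_analytifiedVectorBundle_mem_coniveauFiltration_one
    (hX : IsSmoothProjective n X) (A : HodgeModel n X) {F : X.left.Modules}
    (𝓕 : A.AnalytifiedVectorBundle Fib F) {U : X.left.Opens} (hU : (U : Set X.left).Nonempty)
    (hF : IsFinLocallyFreeOn F U) {i : ℕ} (hi : 0 < i) :
    chernClassZ (({ F := Fib, E := 𝓕.bundle } : ComplexVectorBundle.{0, 0} A.carrier).pullback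
        ⟨A.isAnalytification.homeomorph.symm, A.isAnalytification.homeomorph.continuous_symm⟩) i ∈
      coniveauFiltration ℤ X (2 * i) 1 :=
  chernClassZ_analytification_mem_coniveauFiltration_one_of_isFinLocallyFreeOn (I := 𝓘(ℂ, A.model))
    hX A.isAnalytification.homeomorph 𝓕.isAnalytifiedVectorBundle hU hF hi

end HodgeModelAnalytification

end Literature.AlgebraicGeometry.HodgeTheory

end
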